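import Literature.AlgebraicGeometry.Resolution.MuPTorsorLocalUniformizationFFinite
import Summits.ResolutionOfSingularities.ResolutionOfSingularities.Theorems.SoloInformedMuPTorsor
import HarnessLib

/-!
# The `μ_p`-torsor core of resolution over imperfect (F-finite) ground fields

Summit-side consequences of `Literature/…/MuPTorsorLocalUniformizationFFinite.lean` (Temkin 2013,
Rem. 1.3.5 (ii) over F-finite ground fields `[k : k^p] < ∞`):

* `muPTorsorLocalUniformizationInChar_of_resolutionInChar` — resolution in characteristic `p`
  implies the `μ_p`-torsor steps of local uniformization over EVERY ground field of
  characteristic `p` (no perfectness);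
* `not_resolutionOfSingularities_of_not_muPTorsorStepsAt_inChar` — kill switch at a single
  valuation ring over an arbitrary ground field of characteristic `p`;
* `hasResolution_of_muPTorsorFFinite_of_projPatching` — over an F-finite ground field `k` of
  characteristic `p`, Temkin's inseparable local uniformization + the torsor steps over F-finite
  fields + two-model patching of projective models give weak resolution of every reduced separated
  `k`-scheme of finite type (the `k`-instance of `ResolutionInChar p`). This removes the
  perfectness hypothesis of `hasResolution_of_muPTorsor_of_projPatching` up to F-finiteness; the
  case `[k : k^p] = ∞` remains outside (see the Literature file's header).
-/

noncomputable section

universe u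

namespace Summit.ResolutionOfSingularities.ResolutionOfSingularities.Theorems

open CategoryTheory AlgebraicGeometry IsLocalRing
open Literature.AlgebraicGeometry Literature.AlgebraicGeometry.Resolution

/-- **Resolution in characteristic `p` implies the `μ_p`-torsor steps of local uniformization
over every ground field of characteristic `p`.** -/
theorem muPTorsorLocalUniformizationInChar_of_resolutionInChar {p : ℕ}
    (h : ResolutionInChar.{u} p) : MuPTorsorLocalUniformizationInChar.{u} p :=
  h.localUniformizationInChar.muPTorsorInChar

/-- **The summit implies the `μ_p`-torsor steps over every ground field of characteristic `p`,
for every prime `p`.** -/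
theorem muPTorsorLocalUniformizationInChar_of_resolutionOfSingularities
    (h : Literature.AlgebraicGeometry.Resolution.ResolutionOfSingularities) (p : ℕ)
    (hp : p.Prime) : MuPTorsorLocalUniformizationInChar.{0} p :=
  muPTorsorLocalUniformizationInChar_of_resolutionInChar (h p hp)

/-- **Kill switch at one valuation ring, arbitrary ground field.** ONE valuation ring `O` of ONE
extension `K` of ONE field `k` of characteristic `p` (perfect or not) at which some `μ_p`-torsor
step `K₀ ⊆ K₀(a^{1/p})` inside `K` destroys local uniformizability refutes resolution of
singularities in positive characteristic. -/
theorem not_resolutionOfSingularities_of_not_muPTorsorStepsAt_inChar {p : ℕ} (hp : p.Prime)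
    {k K : Type} [Field k] [CharP k p] [Field K] [Algebra k K] (O : ValuationSubring K)
    (h : ¬ MuPTorsorStepsAt p k O) :
    ¬ Literature.AlgebraicGeometry.Resolution.ResolutionOfSingularities :=
  fun hR => h (muPTorsorLocalUniformizationInChar_of_resolutionOfSingularities hR p hp k K O)

/-- Resolution in characteristic `p` gives local uniformization over F-finite ground fields. -/
theorem localUniformizationFFiniteInChar_of_resolutionInChar {p : ℕ}
    (h : ResolutionInChar.{u} p) : LocalUniformizationFFiniteInChar.{u} p :=
  h.localUniformizationInChar.ffinite

/-- **Local uniformization over an F-finite field from the `μ_p`-torsor steps** (Temkin 2013,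
Rem. 1.3.5 (ii), the `k`-instance): under `Temkin2013` and the torsor steps over F-finite ground
fields, every valuation ring `O ⊇ k` of a finitely generated extension of an F-finite field `k`
of characteristic `p` is locally uniformizable. -/
theorem isLocallyUniformizable_of_muPTorsorFFinite {p : ℕ} [Fact p.Prime] (hT : Temkin2013.{u})
    (H : MuPTorsorLocalUniformizationFFinite.{u} p) {k K : Type u} [Field k] [CharP k p]
    [Field K] [Algebra k K] (hF : FrobeniusFinite p k) (hfg : (⊤ : IntermediateField k K).FG)
    (O : ValuationSubring K) (hk : ∀ c : k, algebraMap k K c ∈ O) :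
    IsLocallyUniformizable k K O :=
  H.localUniformizationFFinite hT k K hF hfg O hk

/-- **Resolution over an F-finite field of characteristic `p` from: Temkin's inseparable local
uniformization, the `μ_p`-torsor steps over F-finite ground fields, and two-model patching of
projective models over `k`.** Same proof as `hasResolution_of_muPTorsor_of_projPatching`, with
perfectness of `k` replaced by `[k : k^p] < ∞`. -/
theorem hasResolution_of_muPTorsorFFinite_of_projPatching {p : ℕ} [Fact p.Prime]
    (hT : Temkin2013.{u}) (H : MuPTorsorLocalUniformizationFFinite.{u} p) {k : Type u}
    [Field k] [CharP k p] (hF : FrobeniusFinite p k)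
    (hZ : ∀ (K : Type u) [Field K] [Algebra k K] [Algebra.EssFiniteType k K],
      ∀ M₁ M₂ : ProjModel k K,
        ∃ (N : ProjModel k K) (φ₁ : N.Hom M₁) (φ₂ : N.Hom M₂), φ₁.RegLe ∧ φ₂.RegLe)
    (X : Scheme.{u}) (f : X ⟶ Spec (.of k)) (hs : IsSeparated f) (hl : LocallyOfFiniteType f)
    (hq : QuasiCompact f) (hr : IsReduced X) : Scheme.HasResolution X := by
  haveI : QuasiCompact f := hq
  haveI : LocallyOfFiniteType f := hl
  haveI : CompactSpace X := QuasiCompact.compactSpace_of_compactSpace f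
  obtain ⟨d, hd⟩ := exists_topologicalKrullDim_le_of_locallyOfFiniteType f
  have hU : ∀ (K : Type u) [Field K] [Algebra k K] (A₀ : Subalgebra k K), A₀.FG →
      IsFractionRing A₀ K → ∀ v : ZariskiRiemannSpace k K, ∃ T : Subalgebra k K,
        (T.FG ∧ IsFractionRing T K) ∧ ZariskiRiemannSpace.HasRegularCentre T v := by
    intro K _ _ A₀ hA₀fg hA₀fr v
    haveI : Algebra.FiniteType k A₀ := A₀.fg_iff_finiteType.mp hA₀fg
    haveI : Algebra.EssFiniteType A₀ K :=
      Algebra.EssFiniteType.of_isLocalization K (nonZeroDivisors A₀)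
    have hKfg : (⊤ : IntermediateField k K).FG :=
      IntermediateField.fg_top_iff.mpr (Algebra.EssFiniteType.comp k A₀ K)
    exact exists_hasRegularCentre_of_lu
      (fun O hO => isLocallyUniformizable_of_muPTorsorFFinite hT H hF hKfg O hO) v
  refine ResolutionOverUpToDim.of_projective (k := k) (d := d) (fun _ Y ι hι hint _ => ?_)
    X f hs hl hq hr hd
  haveI := hι
  haveI := hint
  exact hasResolution_of_twoModelPatching_of_uniformizable hZ hU Y ι

/-- The same, packaged as the `k`-instance of `ResolutionOverUpToDim k d` for every `d`. -/
theorem resolutionOverUpToDim_of_muPTorsorFFinite_of_projPatching {p : ℕ} [Fact p.Prime]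
    (hT : Temkin2013.{u}) (H : MuPTorsorLocalUniformizationFFinite.{u} p) {k : Type u}
    [Field k] [CharP k p] (hF : FrobeniusFinite p k)
    (hZ : ∀ (K : Type u) [Field K] [Algebra k K] [Algebra.EssFiniteType k K],
      ∀ M₁ M₂ : ProjModel k K,
        ∃ (N : ProjModel k K) (φ₁ : N.Hom M₁) (φ₂ : N.Hom M₂), φ₁.RegLe ∧ φ₂.RegLe)
    (d : ℕ) : ResolutionOverUpToDim k d :=
  fun X f hs hl hq hr _ =>
    hasResolution_of_muPTorsorFFinite_of_projPatching hT H hF hZ X f hs hl hq hr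

/-- **Over F-finite fields, the torsor problem over ALL ground fields suffices** (with Temkin and
patching): the form in which a proof of the torsor case "over regular schemes" would be used. -/
theorem resolutionOverUpToDim_of_muPTorsorInChar_of_projPatching {p : ℕ} [Fact p.Prime]
    (hT : Temkin2013.{u}) (H : MuPTorsorLocalUniformizationInChar.{u} p) {k : Type u}
    [Field k] [CharP k p] (hF : FrobeniusFinite p k)
    (hZ : ∀ (K : Type u) [Field K] [Algebra k K] [Algebra.EssFiniteType k K],
      ∀ M₁ M₂ : ProjModel k K,
        ∃ (N : ProjModel k K) (φ₁ : N.Hom M₁) (φ₂ : N.Hom M₂), φ₁.RegLe ∧ φ₂.RegLe)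
    (d : ℕ) : ResolutionOverUpToDim k d :=
  resolutionOverUpToDim_of_muPTorsorFFinite_of_projPatching hT H.ffinite hF hZ d

end Summit.ResolutionOfSingularities.ResolutionOfSingularities.Theorems

end
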